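import Literature.Geometry.Riemannian.ShrinkerDistanceComparison
import Literature.Geometry.Riemannian.RicciFlowDistanceTimeTaylor
import Literature.Geometry.Lorentzian.GeodesicContinuousDependence
import Literature.Geometry.Lorentzian.RicciSection
import Mathlib.Analysis.SpecialFunctions.Integrals.Basic
import HarnessLib

/-!
# Directional second-order upper barriers for the distance at the far end of a geodesic, with the
# `sin`-fields of Bamler's proof of `(∂ₜ − Δ_x − Δ_y) d_t² ≥ −H_n` (Bamler 2020a, Thm. 3.5)

R. Bamler, *Entropy and heat kernel bounds on a Ricci flow background*, arXiv:2008.07093 (2020a),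
§3.2, proof of Thm. 3.5: for a unit speed minimising geodesic `γ : [0, d] → M` from `x` to `y`
and a parallel orthonormal frame `e₁ = γ′, e₂, …, e_n`, the variations with fields
`vᵢ(s) = sin(πs/2d) eᵢ(s)` give `(Δ_y d²)`-barriers whose second variations sum to
`(n−1)π²/4 − 2d ∫ sin²(πs/2d) Ric(γ′, γ′)` plus `2` from the radial direction. This file
produces exactly this DIRECTIONAL DATUM at the far end `γ(T)` of a unit speed geodesic
`γ(t) = exp_p(tu)` of a complete Riemannian manifold (no minimality and no cut-locus hypothesis:
all bounds are lengths/energies of explicit curves):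

* `expMap_smul_velocity_eq` — `exp_{γ(T)}(σ γ̇(T)) = γ(T + σ)` (uniqueness of geodesics);
* `edist_toReal_le_of_unit_speed` — `d(γ 0, γ T′) ≤ T′` for `T′ ≥ 0` along a unit speed curve;
* `exists_sin_cutoff` — a `C^∞` profile `φ` vanishing off `(−1/2, T + 1/2)` and equal to
  `sin(πs/2T)` on `(−1/4, T + 1/4)`;
* `far_end_directional_datum` — an orthonormal frame `f` at `γ(T)` headed by `γ̇(T)`, the EXACT
  radial barrier `d(p, exp_{γT}(σ f none)) ≤ T + σ` (`|σ| < T`), for every `ε > 0` the transverse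
  barriers `d(p, exp_{γT}(σ f o)) ≤ T + [o = none] σ + (Q o + εT)/2 · σ²` for `σ` near `0`
  (`HaslhoferMuller.edist_toReal_le_taylor` for the fields `φ eₒ`), and the identity
  `Σₒ Q o − Q none = −∫₀ᵀ sin²(πs/2T) Ric(γ̇, γ̇) + (dim M − 1) π²/(8T)`.

Everything is proved; no definitions, no named facts.

## References

* R. H. Bamler, *Entropy and heat kernel bounds on a Ricci flow background*, arXiv:2008.07093
  (2020), §3.2, proof of Thm. 3.5. [Bamler2020Entropy]
* J. M. Lee, *Introduction to Riemannian Manifolds* (2018), Thm. 10.22 (second variation).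
-/

noncomputable section

open Bundle Set Function Filter MeasureTheory intervalIntegral
open scoped Manifold ContDiff Topology ENNReal NNReal Real

namespace Literature.Geometry.Riemannian

open Lorentzian Lorentzian.PseudoRiemannianMetric

/-! ### The smooth `sin` profile with compact support -/

/-- **A `C^∞` profile equal to `sin(πs/2T)` near `[0, T]` and vanishing off `(−1/2, T + 1/2)`**
(product of the `sin` with a smooth plateau bump from `Real.smoothTransition`). [folklore] -/
theorem exists_sin_cutoff {T : ℝ} (hT : 0 < T) :
    ∃ φ : ℝ → ℝ, ContDiff ℝ ∞ φ ∧
      (∀ s ∈ Ioo (-(1 / 4 : ℝ)) (T + 1 / 4), φ s = Real.sin (π * s / (2 * T))) ∧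
      (∀ s, s ≤ -(1 / 2 : ℝ) → φ s = 0) ∧ (∀ s, T + 1 / 2 ≤ s → φ s = 0) := by
  have _ := hT
  refine ⟨fun s ↦ (Real.smoothTransition (4 * s + 2) * Real.smoothTransition (4 * (T - s) + 2)) *
    Real.sin (π * s / (2 * T)), ?_, ?_, ?_, ?_⟩
  · exact ((Real.smoothTransition.contDiff.comp ((contDiff_const.mul contDiff_id).add contDiff_const)).mul
      (Real.smoothTransition.contDiff.comp ((contDiff_const.mul (contDiff_const.sub contDiff_id)).add
        contDiff_const))).mul (Real.contDiff_sin.comp ((contDiff_const.mul contDiff_id).div_const _))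
  · intro s hs
    simp only
    rw [Real.smoothTransition.one_of_one_le (by linarith [hs.1]),
      Real.smoothTransition.one_of_one_le (by linarith [hs.2]), one_mul, one_mul]
  · intro s hs
    simp only
    rw [Real.smoothTransition.zero_of_nonpos (by linarith), zero_mul, zero_mul]
  · intro s hs
    simp only
    rw [Real.smoothTransition.zero_of_nonpos (x := 4 * (T - s) + 2) (by linarith), mul_zero, zero_mul]

/-- `∫₀ᵀ cos²(πs/2T) ds = T/2`. [folklore] -/
theorem integral_cos_sq_profile {T : ℝ} (hT : 0 < T) :
    ∫ s in (0 : ℝ)..T, Real.cos (π * s / (2 * T)) ^ 2 = T / 2 := by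
  have hc : π / (2 * T) ≠ 0 := by positivity
  have h1 : (fun s ↦ Real.cos (π * s / (2 * T)) ^ 2) = fun s ↦ (fun x ↦ Real.cos x ^ 2) (π / (2 * T) * s) := by
    funext s; congr 2; ring
  rw [h1, intervalIntegral.integral_comp_mul_left (fun x ↦ Real.cos x ^ 2) hc, integral_cos_sq]
  have e : π / (2 * T) * T = π / 2 := by field_simp
  simp only [mul_zero, Real.cos_zero, Real.sin_zero, sub_zero, e, Real.cos_pi_div_two, zero_mul,
    zero_add, smul_eq_mul]
  field_simp

section FarEnd

variable {E : Type*} [NormedAddCommGroup E] [NormedSpace ℝ E] [FiniteDimensional ℝ E]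
  [CompleteSpace E] {M : Type*} [TopologicalSpace M] [ChartedSpace E M] [IsManifold 𝓘(ℝ, E) ∞ M]
  [T2Space M]
  (g : PseudoRiemannianMetric 𝓘(ℝ, E) ∞ E (TangentSpace 𝓘(ℝ, E) : M → Type _)) [g.HasLeviCivita]
  [CovariantDerivative.ContMDiffCovariantDerivative g.leviCivita 1]
  [CovariantDerivative.ContMDiffCovariantDerivative g.leviCivita ∞]

omit [CovariantDerivative.ContMDiffCovariantDerivative g.leviCivita ∞] in
/-- **`exp_{γ(T)}(σ γ̇(T)) = γ(T + σ)`** for the geodesic `γ(t) = exp_p(tu)` of a complete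
connection (the translate `t ↦ γ(t + T)` is the geodesic with initial data `(γ T, γ̇ T)`,
`IsGeodesic.eq_maximalGeodesic`). [cite: LeeRiemannianManifolds2018, Prop. 5.19] -/
theorem expMap_smul_velocity_eq (hc : IsGeodesicallyComplete g.leviCivita) (p : M)
    (u : TangentSpace 𝓘(ℝ, E) p) (T σ : ℝ) :
    expMap g.leviCivita (expMap g.leviCivita p (T • u))
        (σ • velocity 𝓘(ℝ, E) (fun t ↦ expMap g.leviCivita p (t • u)) T) =
      expMap g.leviCivita p ((T + σ) • u) := by
  set γ : ℝ → M := fun t ↦ expMap g.leviCivita p (t • u) with hγ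
  have hgeo : IsGeodesic g.leviCivita γ := isGeodesic_expMap_smul_of_isGeodesicallyComplete hc p u
  have hsh : IsGeodesic g.leviCivita (fun t ↦ γ (t + T)) := by
    have := hgeo.comp_affine 1 T
    simpa only [one_mul] using this
  have hlift : tangentLift 𝓘(ℝ, E) (fun t ↦ γ (t + T)) 0 =
      (⟨γ T, velocity 𝓘(ℝ, E) γ T⟩ : TangentBundle 𝓘(ℝ, E) M) := by
    have hv : velocity 𝓘(ℝ, E) (fun t ↦ γ (t + T)) 0 = cast (by rw [zero_add]) (velocity 𝓘(ℝ, E) γ T) := by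
      rw [velocity_translate]
      exact (cast_eq_iff_heq.2 (by rw [zero_add])).symm
    refine TotalSpace.ext (by simp) ?_
    show HEq (velocity 𝓘(ℝ, E) (fun t ↦ γ (t + T)) 0) (velocity 𝓘(ℝ, E) γ T)
    rw [hv]
    exact cast_heq _ _
  have heq := hsh.eq_maximalGeodesic hlift
  have h1 : expMap g.leviCivita (γ T) (σ • velocity 𝓘(ℝ, E) γ T) =
      maximalGeodesic g.leviCivita (γ T) (velocity 𝓘(ℝ, E) γ T) σ := expMap_smul hc _ _ σ
  rw [h1, ← congrFun heq σ]
  show γ (σ + T) = expMap g.leviCivita p ((T + σ) • u)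
  rw [hγ, add_comm]

omit [CompleteSpace E] [T2Space M] [g.HasLeviCivita]
  [CovariantDerivative.ContMDiffCovariantDerivative g.leviCivita 1]
  [CovariantDerivative.ContMDiffCovariantDerivative g.leviCivita ∞] in
/-- **`d(γ 0, γ T′) ≤ T′`** for `T′ ≥ 0` along a `C^∞` curve of unit speed on `[0, T′]` (distance
≤ length). [folklore] -/
theorem edist_toReal_le_of_unit_speed (hg : g.IsRiemannian) {γ : ℝ → M}
    (hγ : ContMDiff 𝓘(ℝ, ℝ) 𝓘(ℝ, E) ∞ γ) {T' : ℝ} (hT' : 0 ≤ T')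
    (hspeed : ∀ s, g.val (γ s) (velocity 𝓘(ℝ, E) γ s) (velocity 𝓘(ℝ, E) γ s) = 1) :
    g.edist hg (γ 0) (γ T') ≠ ⊤ ∧ (g.edist hg (γ 0) (γ T')).toReal ≤ T' := by
  obtain ⟨hfin, hsq⟩ := edist_toReal_sq_le_mul_integral_val_velocity g hg hγ hT'
  refine ⟨hfin, ?_⟩
  have h1 : ∫ s in (0 : ℝ)..T', g.val (γ s) (velocity 𝓘(ℝ, E) γ s) (velocity 𝓘(ℝ, E) γ s) = T' := by
    rw [intervalIntegral.integral_congr (g := fun _ ↦ (1 : ℝ)) (fun s _ ↦ hspeed s)]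
    simp
  rw [h1] at hsq
  have h0 : 0 ≤ (g.edist hg (γ 0) (γ T')).toReal := ENNReal.toReal_nonneg
  nlinarith

omit [T2Space M] [CovariantDerivative.ContMDiffCovariantDerivative g.leviCivita 1]
  [CovariantDerivative.ContMDiffCovariantDerivative g.leviCivita ∞] in
/-- **`Ric(A, B)` is `C^∞` for `C^∞` fields `A, B` along a map** (the Ricci tensor is a smooth
section of the bundle of bilinear forms, `contMDiff_ricciCLM`; Mathlib's
`ContMDiffAt.clm_bundle_apply₂`). [folklore] -/
theorem contMDiffAt_ricci_apply_along {N : Type*} [TopologicalSpace N] [ChartedSpace ℝ N]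
    {f : N → M} {A B : Π y : N, TangentSpace 𝓘(ℝ, E) (f y)} {y : N}
    (hA : ContMDiffAt 𝓘(ℝ, ℝ) 𝓘(ℝ, E).tangent ∞
      (fun y ↦ (TotalSpace.mk' E (f y) (A y) : TangentBundle 𝓘(ℝ, E) M)) y)
    (hB : ContMDiffAt 𝓘(ℝ, ℝ) 𝓘(ℝ, E).tangent ∞
      (fun y ↦ (TotalSpace.mk' E (f y) (B y) : TangentBundle 𝓘(ℝ, E) M)) y) :
    ContMDiffAt 𝓘(ℝ, ℝ) 𝓘(ℝ, ℝ) ∞ (fun y ↦ g.leviCivita.ricci (f y) (A y) (B y)) y := by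
  have hf : ContMDiffAt 𝓘(ℝ, ℝ) 𝓘(ℝ, E) ∞ f y := (contMDiffAt_totalSpace.1 hA).1
  have hg : ContMDiffAt 𝓘(ℝ, ℝ) (𝓘(ℝ, E).prod 𝓘(ℝ, E →L[ℝ] E →L[ℝ] ℝ)) ∞
      (fun y ↦ TotalSpace.mk' (E →L[ℝ] E →L[ℝ] ℝ)
        (E := fun x : M ↦ TangentSpace 𝓘(ℝ, E) x →L[ℝ] TangentSpace 𝓘(ℝ, E) x →L[ℝ] ℝ) (f y)
          (g.ricciCLM (f y))) y :=
    (contMDiff_ricciCLM g (f y)).comp y hf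
  have : ContMDiffAt 𝓘(ℝ, ℝ) (𝓘(ℝ, E).prod 𝓘(ℝ, ℝ)) ∞
      (fun y ↦ TotalSpace.mk' ℝ (E := Bundle.Trivial M ℝ) (f y) (g.ricciCLM (f y) (A y) (B y))) y := by
    apply ContMDiffAt.clm_bundle_apply₂ (F₁ := E) (F₂ := E)
    · exact hg
    · exact hA
    · exact hB
  simp only [contMDiffAt_totalSpace] at this
  exact this.2

/-- **The directional datum at the far end of a unit speed geodesic** `γ(t) = exp_p(tu)`,
`T > 0`, on a complete Riemannian manifold: a `g`-orthonormal frame `f` at `γ(T)` headed by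
`γ̇(T)`; the exact radial barrier `d(p, exp_{γT}(σ f none)) ≤ T + σ` for `|σ| < T`; for every
`ε > 0` the barriers `d(p, exp_{γT}(σ f o)) ≤ T + [o = none] σ + (Q o + εT)/2 · σ²` for `σ` near
`0` along the `sin`-fields `sin(πs/2T) eₒ(s)` of a parallel frame (second variation,
`HaslhoferMuller.edist_toReal_le_taylor`); and the trace identity
`Σₒ Q o − Q none = −∫₀ᵀ sin²(πs/2T) Ric(γ̇, γ̇) ds + (dim M − 1) π²/(8T)`.
[cite: Bamler2020Entropy, §3.2, proof of Thm. 3.5] -/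
theorem far_end_directional_datum (hg : g.IsRiemannian) (hc : IsGeodesicallyComplete g.leviCivita)
    (p : M) (u : TangentSpace 𝓘(ℝ, E) p) (hu : g.val p u u = 1) {T : ℝ} (hT : 0 < T) :
    ∃ (k : ℕ) (f : Option (Fin k) → TangentSpace 𝓘(ℝ, E) (expMap g.leviCivita p (T • u)))
      (Q : Option (Fin k) → ℝ),
      Fintype.card (Option (Fin k)) = Module.finrank ℝ E ∧
      (∀ o o', g.val (expMap g.leviCivita p (T • u)) (f o) (f o') = if o = o' then 1 else 0) ∧
      f none = velocity 𝓘(ℝ, E) (fun t ↦ expMap g.leviCivita p (t • u)) T ∧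
      (∀ σ ∈ Ioo (-T) T, (g.edist hg p
        (expMap g.leviCivita (expMap g.leviCivita p (T • u)) (σ • f none))).toReal ≤ T + σ) ∧
      (∀ o, ∀ ε > 0, ∀ᶠ σ in 𝓝 (0 : ℝ),
        (g.edist hg p (expMap g.leviCivita (expMap g.leviCivita p (T • u)) (σ • f o))).toReal ≤
          T + (if o = none then σ else 0) + (Q o + ε * T) / 2 * σ ^ 2) ∧
      (∑ o, Q o) - Q none =
        -(∫ s in (0 : ℝ)..T, Real.sin (π * s / (2 * T)) ^ 2 *
            g.leviCivita.ricci (expMap g.leviCivita p (s • u))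
              (velocity 𝓘(ℝ, E) (fun t ↦ expMap g.leviCivita p (t • u)) s)
              (velocity 𝓘(ℝ, E) (fun t ↦ expMap g.leviCivita p (t • u)) s)) +
          ((Module.finrank ℝ E : ℝ) - 1) * (π ^ 2 / (8 * T)) := by
  classical
  have hLC := PseudoRiemannianMetric.isLeviCivita_leviCivita_holds (g := g)
  have hreg : g.leviCivita.IsLocallyContMDiff ∞ := hLC.isLocallyContMDiff ⊤ (le_of_eq rfl)
  have hreg1 : g.leviCivita.IsLocallyContMDiff 1 := hLC.isLocallyContMDiff 1 (by exact_mod_cast le_top)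
  have h2 : (2 : ℕ∞ω) ≤ (∞ : ℕ∞ω) := WithTop.coe_le_coe.2 le_top
  haveI : Fact ((1 : ℕ∞ω) ≤ (∞ : ℕ∞ω)) := ⟨by exact_mod_cast le_top⟩
  -- the geodesic
  set γ : ℝ → M := fun t ↦ expMap g.leviCivita p (t • u) with hγ_def
  have hgeo : IsGeodesic g.leviCivita γ := isGeodesic_expMap_smul_of_isGeodesicallyComplete hc p u
  have hγfun : γ = maximalGeodesic g.leviCivita p u := funext fun t ↦ expMap_smul hc p u t
  have hγs : ContMDiff 𝓘(ℝ, ℝ) 𝓘(ℝ, E) ∞ γ := by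
    rw [hγfun]
    exact (contMDiff_maximalGeodesic_family hc p).comp
      (contMDiff_id.prodMk (contMDiff_const (c := (show E from u))))
  have hγd : ∀ t, MDifferentiableAt 𝓘(ℝ, ℝ) 𝓘(ℝ, E) γ t := fun t ↦
    mdifferentiableAt_of_mdifferentiableAt_lift (hgeo.1 t (mem_univ t))
  have hγc : ∀ t, ContinuousAt (tangentLift 𝓘(ℝ, E) γ) t := fun t ↦
    (hgeo.1 t (mem_univ t)).continuousAt
  have hγ0 : γ 0 = p := by
    show expMap g.leviCivita p ((0 : ℝ) • u) = p
    rw [zero_smul]; exact expMap_zero (cov := g.leviCivita) p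
  have hspeed : ∀ t, g.val (γ t) (velocity 𝓘(ℝ, E) γ t) (velocity 𝓘(ℝ, E) γ t) = 1 := by
    intro t
    have h := g.val_velocity_eq_of_isGeodesicOn_holds isOpen_univ ordConnected_univ hgeo
      (mem_univ t) (mem_univ 0)
    have hv0 : (velocity 𝓘(ℝ, E) γ 0 : E) = (u : E) := velocity_expMap_smul_zero p u
    rw [h, hv0, hγ0, hu]
  -- the frame at `γ T` headed by `γ̇ T`, transported along `γ` on `(-1, T + 1)`
  obtain ⟨k, f₀, hf₀none, hf₀on, hcard⟩ := exists_orthonormal_frame_with_head g hg (γ T) (hspeed T)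
  have hT₀ : T ∈ Ioo (-1 : ℝ) (T + 1) := ⟨by linarith, by linarith⟩
  obtain ⟨e, he0, hepar, heon⟩ :=
    exists_parallel_orthonormal_frame_Ioo' g hg hLC.2 hreg hγd hγc hT₀ f₀ hf₀on
  have helift : ∀ o, ∀ t ∈ Ioo (-1 : ℝ) (T + 1), ContMDiffAt 𝓘(ℝ, ℝ) 𝓘(ℝ, E).tangent ∞
      (fun t ↦ (TotalSpace.mk' E (γ t) (e o t) : TangentBundle 𝓘(ℝ, E) M)) t := fun o t ht ↦
    HaslhoferMuller.contMDiffAt_lift_of_isParallelAlongOn g.leviCivita hreg hγs isOpen_Ioo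
      (hepar o) ht
  -- the head of the frame is the velocity (both are parallel and agree at `T`)
  have hhead : ∀ t ∈ Ioo (-1 : ℝ) (T + 1), e none t = velocity 𝓘(ℝ, E) γ t := by
    intro t ht
    have hvelpar : IsParallelAlongOn g.leviCivita γ (fun t ↦ velocity 𝓘(ℝ, E) γ t)
        (Ioo (-1 : ℝ) (T + 1)) :=
      (IsGeodesicOn.isParallelAlongOn_velocity (hgeo.isGeodesicOn univ)).mono (subset_univ _)
    exact eq_of_isParallelAlongOn g hg hLC.2 ordConnected_Ioo (hepar none) hvelpar hT₀
      ((he0 none).trans hf₀none) ht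
  -- the profile and the variation fields `X_o = φ • e_o`
  obtain ⟨φ, hφs, hφsin, hφneg, hφge⟩ := exists_sin_cutoff hT
  set X : Option (Fin k) → Π t : ℝ, TangentSpace 𝓘(ℝ, E) (γ t) := fun o t ↦ φ t • e o t
    with hX_def
  have hzeroLift : ContMDiff 𝓘(ℝ, ℝ) 𝓘(ℝ, E).tangent ∞
      (fun t ↦ (TotalSpace.mk' E (γ t) (0 : TangentSpace 𝓘(ℝ, E) (γ t)) :
        TangentBundle 𝓘(ℝ, E) M)) :=
    (contMDiff_zeroSection ℝ (TangentSpace 𝓘(ℝ, E) : M → Type _)).comp hγs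
  have hXs : ∀ o, ContMDiff 𝓘(ℝ, ℝ) 𝓘(ℝ, E).tangent ∞
      (fun t ↦ (TotalSpace.mk' E (γ t) (X o t) : TangentBundle 𝓘(ℝ, E) M)) := by
    intro o t
    by_cases ht : t ∈ Ioo (-1 : ℝ) (T + 1)
    · exact contMDiffAt_liftAlong_smul (helift o t ht) (hφs.contDiffAt.contMDiffAt)
    · refine (hzeroLift t).congr_of_eventuallyEq ?_
      rcases le_or_gt t (-1) with hle | hgt
      · filter_upwards [(isOpen_gt' (-(1 / 2) : ℝ)).mem_nhds (show t < -(1 / 2) by linarith)] with s hs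
        show (TotalSpace.mk' E (γ s) (X o s) : TangentBundle 𝓘(ℝ, E) M) =
          TotalSpace.mk' E (γ s) (0 : TangentSpace 𝓘(ℝ, E) (γ s))
        rw [hX_def]
        simp only [hφneg s (le_of_lt hs), zero_smul]
      · have hge : T + 1 ≤ t := by
          by_contra hlt
          exact ht ⟨hgt, lt_of_not_ge hlt⟩
        filter_upwards [(isOpen_lt' (T + 1 / 2)).mem_nhds (show T + 1 / 2 < t by linarith)]
          with s hs
        show (TotalSpace.mk' E (γ s) (X o s) : TangentBundle 𝓘(ℝ, E) M) =
          TotalSpace.mk' E (γ s) (0 : TangentSpace 𝓘(ℝ, E) (γ s))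
        rw [hX_def]
        simp only [hφge s (le_of_lt hs), zero_smul]
  have hφ0 : φ 0 = 0 := by
    rw [hφsin 0 ⟨by norm_num, by linarith⟩]; simp
  have hφT : φ T = 1 := by
    rw [hφsin T ⟨by linarith, by linarith⟩]
    have : π * T / (2 * T) = π / 2 := by field_simp
    rw [this, Real.sin_pi_div_two]
  have hX0 : ∀ o, X o 0 = 0 := fun o ↦ by
    show φ 0 • e o 0 = 0
    rw [hφ0, zero_smul]
  have hXT : ∀ o, X o T = f₀ o := fun o ↦ by
    show φ T • e o T = f₀ o
    rw [hφT, one_smul, he0]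
  -- the index integrands and their integrals
  set qf : Option (Fin k) → ℝ → ℝ := fun o t ↦
    g.val (γ t) (g.leviCivita.curvature (γ t) (X o t) (velocity 𝓘(ℝ, E) γ t) (X o t))
        (velocity 𝓘(ℝ, E) γ t) +
      g.val (γ t) (covariantDerivAlong g.leviCivita γ (X o) t)
        (covariantDerivAlong g.leviCivita γ (X o) t) with hqf_def
  have hqfc : ∀ o, Continuous (qf o) := fun o ↦
    (integral_energy_le_taylor g le_rfl hc (hXs o) hT.le).1
  set Q : Option (Fin k) → ℝ := fun o ↦ ∫ t in (0 : ℝ)..T, qf o t with hQ_def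
  -- the Taylor barriers (every direction, every `ε`)
  have hbar : ∀ o, ∀ ε > 0, ∀ᶠ σ in 𝓝 (0 : ℝ),
      (g.edist hg p (expMap g.leviCivita (expMap g.leviCivita p (T • u)) (σ • f₀ o))).toReal ≤
        T + (if o = none then σ else 0) + (Q o + ε * T) / 2 * σ ^ 2 := by
    intro o ε hε
    obtain ⟨δ, hδ, hδ'⟩ :=
      HaslhoferMuller.edist_toReal_le_taylor g le_rfl hg hc p u hu (hXs o) (hX0 o) hT ε hε
    filter_upwards [Icc_mem_nhds (show -δ < 0 by linarith) hδ] with σ hσ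
    have h := hδ' σ hσ
    have ha : g.val (expMap g.leviCivita p (T • u)) (f₀ o)
        (velocity 𝓘(ℝ, E) (fun t ↦ expMap g.leviCivita p (t • u)) T) =
        if o = none then 1 else 0 := by
      show g.val (γ T) (f₀ o) (velocity 𝓘(ℝ, E) γ T) = _
      rw [← hf₀none, hf₀on]
    rw [hXT] at h
    rw [ha] at h
    have hif : σ * (if o = none then (1 : ℝ) else 0) = if o = none then σ else 0 := by
      split_ifs <;> simp
    calc (g.edist hg p (expMap g.leviCivita (expMap g.leviCivita p (T • u)) (σ • f₀ o))).toReal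
        ≤ T + σ * (if o = none then (1 : ℝ) else 0) + σ ^ 2 * ((Q o) + ε * T) / 2 := h
      _ = T + (if o = none then σ else 0) + (Q o + ε * T) / 2 * σ ^ 2 := by rw [hif]; ring
  -- the exact radial barrier
  have hrad : ∀ σ ∈ Ioo (-T) T, (g.edist hg p
      (expMap g.leviCivita (expMap g.leviCivita p (T • u)) (σ • f₀ none))).toReal ≤ T + σ := by
    intro σ hσ
    rw [hf₀none, expMap_smul_velocity_eq g hc p u T σ]
    have h1 := (edist_toReal_le_of_unit_speed g hg hγs (T' := T + σ) (by linarith [hσ.1]) hspeed).2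
    rwa [hγ0] at h1
  -- (A) the index integrand of `X_o` in the frame, on the interval
  have hφd : ∀ t, DifferentiableAt ℝ φ t := fun t ↦ (hφs.differentiable (by simp)).differentiableAt
  have hqf : ∀ o, ∀ t ∈ Ioo (-1 : ℝ) (T + 1), qf o t =
      -(φ t ^ 2 * g.val (γ t) (g.leviCivita.curvature (γ t) (e o t) (velocity 𝓘(ℝ, E) γ t)
        (velocity 𝓘(ℝ, E) γ t)) (e o t)) + deriv φ t ^ 2 := by
    intro o t ht
    have hD : covariantDerivAlong g.leviCivita γ (X o) t = deriv φ t • e o t := by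
      have h := covariantDerivAlong_smul_holds g.leviCivita (γ := γ) (W := e o) (f := φ) (t₀ := t)
        (hφd t) (hepar o t ht).1
      rw [(hepar o t ht).2, smul_zero, add_zero] at h
      exact h
    have hcurv : g.val (γ t) (g.leviCivita.curvature (γ t) (X o t) (velocity 𝓘(ℝ, E) γ t) (X o t))
        (velocity 𝓘(ℝ, E) γ t) = φ t ^ 2 * g.val (γ t) (g.leviCivita.curvature (γ t) (e o t)
          (velocity 𝓘(ℝ, E) γ t) (e o t)) (velocity 𝓘(ℝ, E) γ t) := by
      show g.val (γ t) (g.leviCivita.curvature (γ t) (φ t • e o t) (velocity 𝓘(ℝ, E) γ t)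
        (φ t • e o t)) (velocity 𝓘(ℝ, E) γ t) = _
      simp only [map_smul, FunLike.coe_smul, Pi.smul_apply, smul_eq_mul]
      ring
    have hskew := hLC.val_curvature_skew h2 (γ t) (e o t) (velocity 𝓘(ℝ, E) γ t) (e o t)
      (velocity 𝓘(ℝ, E) γ t)
    have hDD : g.val (γ t) (covariantDerivAlong g.leviCivita γ (X o) t)
        (covariantDerivAlong g.leviCivita γ (X o) t) = deriv φ t ^ 2 := by
      rw [hD]
      simp only [map_smul, FunLike.coe_smul, Pi.smul_apply, smul_eq_mul]
      rw [heon t ht o o, if_pos rfl]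
      ring
    show g.val (γ t) (g.leviCivita.curvature (γ t) (X o t) (velocity 𝓘(ℝ, E) γ t) (X o t))
        (velocity 𝓘(ℝ, E) γ t) + g.val (γ t) (covariantDerivAlong g.leviCivita γ (X o) t)
        (covariantDerivAlong g.leviCivita γ (X o) t) = _
    rw [hcurv, hDD, hskew]
    ring
  -- the radial curvature term vanishes (`e none = γ̇`)
  have hqfnone : ∀ t ∈ Ioo (-1 : ℝ) (T + 1), qf none t = deriv φ t ^ 2 := by
    intro t ht
    rw [hqf none t ht, hhead t ht,
      val_curvature_self_eq_zero hLC.2 hreg1 h2 (γ t) (velocity 𝓘(ℝ, E) γ t) (velocity 𝓘(ℝ, E) γ t)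
        (velocity 𝓘(ℝ, E) γ t)]
    ring
  -- (B) summing over the frame: `Σ_o q_o = −φ² Ric(γ̇,γ̇) + card · φ'²`
  have hsum : ∀ t ∈ Ioo (-1 : ℝ) (T + 1), ∑ o, qf o t =
      -(φ t ^ 2 * g.leviCivita.ricci (γ t) (velocity 𝓘(ℝ, E) γ t) (velocity 𝓘(ℝ, E) γ t)) +
        (Fintype.card (Option (Fin k)) : ℝ) * deriv φ t ^ 2 := by
    intro t ht
    have hric := sum_val_curvature_eq_ricci g g.leviCivita (γ t) (heon t ht) hcard
      (velocity 𝓘(ℝ, E) γ t)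
    rw [Finset.sum_congr rfl fun o _ ↦ hqf o t ht, Finset.sum_add_distrib, Finset.sum_const,
      Finset.card_univ, nsmul_eq_mul, Finset.sum_neg_distrib, ← Finset.mul_sum, hric]
  -- (C) the integrals
  have hIoo : uIcc (0 : ℝ) T ⊆ Ioo (-1 : ℝ) (T + 1) := by
    rw [uIcc_of_le hT.le]
    exact fun t ht ↦ ⟨by linarith [ht.1], by linarith [ht.2]⟩
  have hIcc' : uIcc (0 : ℝ) T ⊆ Ioo (-(1 / 4) : ℝ) (T + 1 / 4) := by
    rw [uIcc_of_le hT.le]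
    exact fun t ht ↦ ⟨by linarith [ht.1], by linarith [ht.2]⟩
  -- `deriv φ = (π/2T) cos(π s/2T)` on the interval
  have hφ' : ∀ t ∈ Ioo (-(1 / 4) : ℝ) (T + 1 / 4), deriv φ t = π / (2 * T) * Real.cos (π * t / (2 * T)) := by
    intro t ht
    have hev : φ =ᶠ[𝓝 t] fun s ↦ Real.sin (π * s / (2 * T)) :=
      eventuallyEq_of_mem (isOpen_Ioo.mem_nhds ht) fun s hs ↦ hφsin s hs
    rw [hev.deriv_eq]
    have hd : HasDerivAt (fun s ↦ Real.sin (π * s / (2 * T)))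
        (Real.cos (π * t / (2 * T)) * (π / (2 * T))) t := by
      have h1 : HasDerivAt (fun s ↦ π * s / (2 * T)) (π / (2 * T)) t := by
        have := ((hasDerivAt_id t).const_mul π).div_const (2 * T)
        simpa using this
      exact (Real.hasDerivAt_sin _).comp t h1
    rw [hd.deriv]; ring
  have hric_c : Continuous fun t ↦ g.leviCivita.ricci (γ t) (velocity 𝓘(ℝ, E) γ t) (velocity 𝓘(ℝ, E) γ t) := by
    have hTl := contMDiff_lift_velocity_of_contMDiff (I := 𝓘(ℝ, E)) hγs
    exact (show ContMDiff 𝓘(ℝ, ℝ) 𝓘(ℝ, ℝ) ∞ _ from fun t ↦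
      contMDiffAt_ricci_apply_along g (hTl t) (hTl t)).continuous
  have hsumQ : ∑ o, Q o = -(∫ t in (0 : ℝ)..T, Real.sin (π * t / (2 * T)) ^ 2 *
      g.leviCivita.ricci (γ t) (velocity 𝓘(ℝ, E) γ t) (velocity 𝓘(ℝ, E) γ t)) +
      (Fintype.card (Option (Fin k)) : ℝ) * (π ^ 2 / (8 * T)) := by
    have h1 : ∑ o, Q o = ∫ t in (0 : ℝ)..T, ∑ o, qf o t := by
      rw [intervalIntegral.integral_finsetSum]
      exact fun o _ ↦ (hqfc o).intervalIntegrable _ _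
    rw [h1, intervalIntegral.integral_congr fun t ht ↦ hsum t (hIoo ht)]
    have hI1 : IntervalIntegrable (fun t ↦ -(φ t ^ 2 *
        g.leviCivita.ricci (γ t) (velocity 𝓘(ℝ, E) γ t) (velocity 𝓘(ℝ, E) γ t))) volume 0 T :=
      ((hφs.continuous.pow 2).mul hric_c).neg.intervalIntegrable _ _
    have hI2 : IntervalIntegrable (fun t ↦ (Fintype.card (Option (Fin k)) : ℝ) * deriv φ t ^ 2) volume 0 T :=
      (continuous_const.mul ((hφs.continuous_deriv (by simp)).pow 2)).intervalIntegrable _ _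
    rw [intervalIntegral.integral_add hI1 hI2, intervalIntegral.integral_neg,
      intervalIntegral.integral_const_mul]
    congr 1
    · congr 1
      exact intervalIntegral.integral_congr fun t ht ↦ by
        show φ t ^ 2 * _ = Real.sin (π * t / (2 * T)) ^ 2 * _
        rw [hφsin t (hIcc' ht)]
    · congr 1
      rw [intervalIntegral.integral_congr (g := fun t ↦ (π / (2 * T)) ^ 2 * Real.cos (π * t / (2 * T)) ^ 2)
        (fun t ht ↦ by simp only; rw [hφ' t (hIcc' ht)]; ring), intervalIntegral.integral_const_mul,
        integral_cos_sq_profile hT]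
      field_simp
      ring
  have hQnone : Q none = π ^ 2 / (8 * T) := by
    show ∫ t in (0 : ℝ)..T, qf none t = _
    rw [intervalIntegral.integral_congr fun t ht ↦ hqfnone t (hIoo ht),
      intervalIntegral.integral_congr (g := fun t ↦ (π / (2 * T)) ^ 2 * Real.cos (π * t / (2 * T)) ^ 2)
        (fun t ht ↦ by simp only; rw [hφ' t (hIcc' ht)]; ring), intervalIntegral.integral_const_mul,
      integral_cos_sq_profile hT]
    field_simp
    ring
  -- (D) assembly
  refine ⟨k, f₀, Q, hcard, hf₀on, hf₀none, hrad, hbar, ?_⟩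
  have hcardR : (Fintype.card (Option (Fin k)) : ℝ) = (Module.finrank ℝ E : ℝ) := by
    exact_mod_cast hcard
  rw [hsumQ, hQnone, hcardR]
  ring

end FarEnd

end Literature.Geometry.Riemannian

end
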